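import Literature.AlgebraicGeometry.Motives.OrthogonalRotationGeneration
import Literature.AlgebraicGeometry.Motives.LinearDilationGeneration
import HarnessLib

/-!
# An isometry acting on a pair of isotropic subspaces in duality is a product of hyperbolic rotations across the pair

Generic linear algebra over a field `K` with `2 ≠ 0`, continuing
`OrthogonalRotationGeneration.lean` (hyperbolic rotations `rotation B e f z`) and
`LinearDilationGeneration.lean` (`GL(U)` is generated by dilations). For a nondegenerate symmetric
bilinear form `B` on a finite-dimensional `V` and two totally isotropic subspaces `U, U'` which `B`
puts in perfect duality (every linear functional on `U` is `B(f, ·)|_U` for some `f ∈ U'`, and no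
non-zero vector of `U'` is orthogonal to `U`):

* `isOrthogonal_rotation`: hyperbolic rotations are `B`-isometries;
* `exists_eq_prod_rotations_of_isotropic_pair`: a `B`-isometry `h` preserving `U` and `U'` and
  equal to the identity on `(U + U')^⊥` is a product of hyperbolic rotations `rotation B eᵢ fᵢ zᵢ`
  with `eᵢ ∈ U`, `fᵢ ∈ U'` and `zᵢ ≠ 0`. Proof: `h|_U` is a product of dilations
  `x ↦ x + (z - 1) φ(x) e` (`exists_eq_prod_dilations`); the dilation with `φ = B(f, ·)|_U`,
  `f ∈ U'`, is the restriction to `U` of the rotation in the hyperbolic pair `(e, f)`; and an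
  isometry of this shape is determined by its restriction to `U` (the `GL(U)`-Levi factor of the
  stabiliser of the decomposition `U ⊕ U^∨`; E. Artin, *Geometric Algebra*, Ch. III §4, Ch. IV §1).

Purpose: the CM case of the integration step in the tree's elementary proof of Zarhin's theorem on
the Hodge group of a Hodge structure of K3 type (Huybrechts, *Lectures on K3 Surfaces*, Thm. 3.3.9,
`Hdg(T) = U(T, Ψ)`): an `E`-linear `ψ`-isometry acts on `V_ℂ` through contragredient pairs on
`V_σ ⊕ V_σ̄`, and the resulting rotations have generators preserving every `V_τ`, hence fixing the
complexified Hodge tensors (`OrthogonalRotationTensorInvariance.lean`). No definitions, no named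
facts.

## References

* E. Artin, *Geometric Algebra*, Interscience (1957), Ch. III §4, Ch. IV §1.
* J. Dieudonné, *La géométrie des groupes classiques*, Springer (1955), Ch. II §1.
* D. Huybrechts, *Lectures on K3 Surfaces*, CUP (2016), Thm. 3.3.9.
-/

noncomputable section

namespace Literature.AlgebraicGeometry.Motives

namespace OrthogonalGeneration

universe u v

variable {K : Type u} [Field K] {V : Type v} [AddCommGroup V] [Module K V]

/-- **Hyperbolic rotations are isometries** (symmetric `B`, hyperbolic pair, `z ≠ 0`).
[folklore] -/
theorem isOrthogonal_rotation {B : LinearMap.BilinForm K V} (hB : B.IsSymm) {e f : V}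
    (he : B e e = 0) (hf : B f f = 0) (hef : B e f = 1) {z : K} (hz : z ≠ 0) :
    B.IsOrthogonal (rotation B e f z) := by
  intro x y
  rw [rotation_apply, rotation_apply]
  simp only [map_add, map_smul, LinearMap.add_apply, LinearMap.smul_apply, smul_eq_mul, he, hf, hef,
    hB.eq f e, hB.eq x e, hB.eq x f]
  field_simp
  ring

/-- A word in hyperbolic rotations is an isometry. [folklore] -/
theorem isOrthogonal_prod_rotations {B : LinearMap.BilinForm K V} (hB : B.IsSymm)
    (R : List (V × V × K))
    (hR : ∀ r ∈ R, B r.1 r.1 = 0 ∧ B r.2.1 r.2.1 = 0 ∧ B r.1 r.2.1 = 1 ∧ r.2.2 ≠ 0) :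
    B.IsOrthogonal (R.map fun r => rotation B r.1 r.2.1 r.2.2).prod := by
  induction R with
  | nil => intro x y; simp
  | cons r R ih =>
    intro x y
    obtain ⟨h1, h2, h3, h4⟩ := hR r List.mem_cons_self
    rw [List.map_cons, List.prod_cons, Module.End.mul_apply, Module.End.mul_apply,
      isOrthogonal_rotation hB h1 h2 h3 h4, ih fun r' hr' => hR r' (List.mem_cons_of_mem r hr')]

/-- **An isometry acting on a pair of isotropic subspaces in duality is a product of hyperbolic
rotations across the pair.** Let `B` be nondegenerate symmetric (`2 ≠ 0`), `U, U'` totally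
isotropic subspaces such that `B` puts `U'` in perfect duality with `U` (every functional on `U` is
`B(f, ·)` for some `f ∈ U'`, and no non-zero vector of `U'` is orthogonal to `U`), and `h` a
`B`-isometry preserving `U` and `U'` and equal to the identity on `(U + U')^⊥`. Then
`h = ∏ᵢ rotation B eᵢ fᵢ zᵢ` with `eᵢ ∈ U`, `fᵢ ∈ U'` hyperbolic pairs and `zᵢ ≠ 0`: write `h|_U`
as a product of dilations (`exists_eq_prod_dilations`), realise each dilation `x ↦ x +
(z-1)φ(x)e` as the rotation in the pair `(e, f)` with `B(f, ·)|_U = φ`, and note that an isometry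
of this shape is determined by its restriction to `U` (the classical description of the unitary /
`GL(U)`-Levi action on `U ⊕ U^∨`; E. Artin, *Geometric Algebra*, Ch. III §4, Ch. IV §1).
[folklore] -/
theorem exists_eq_prod_rotations_of_isotropic_pair [NeZero (2 : K)] [FiniteDimensional K V]
    {B : LinearMap.BilinForm K V} (hB : B.IsSymm) (hBn : B.Nondegenerate) (U U' : Submodule K V)
    (hUU : ∀ x ∈ U, ∀ y ∈ U, B x y = 0) (hU'U' : ∀ x ∈ U', ∀ y ∈ U', B x y = 0)
    (hdual : ∀ φ : Module.Dual K U, ∃ f ∈ U', ∀ u : U, B f u = φ u)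
    (hsep : ∀ x ∈ U', (∀ u ∈ U, B x u = 0) → x = 0) (h : Module.End K V) (hh : B.IsOrthogonal h)
    (hU : ∀ u ∈ U, h u ∈ U) (hU' : ∀ x ∈ U', h x ∈ U') (hfix : ∀ w ∈ B.orthogonal (U ⊔ U'), h w = w) :
    ∃ R : List (V × V × K),
      (∀ r ∈ R, r.1 ∈ U ∧ r.2.1 ∈ U' ∧ B r.1 r.1 = 0 ∧ B r.2.1 r.2.1 = 0 ∧ B r.1 r.2.1 = 1 ∧
        r.2.2 ≠ 0) ∧
      h = (R.map fun r => rotation B r.1 r.2.1 r.2.2).prod := by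
  classical
  -- `h|_U` is an automorphism of `U`
  have hker : ∀ x, h x = 0 → x = 0 := by
    intro x hx
    refine hBn.1 x fun y => ?_
    rw [← hh x y, hx, map_zero, LinearMap.zero_apply]
  set hUr : Module.End K U := h.restrict hU with hhUr
  have hUr_inj : Function.Injective hUr := by
    intro a b hab
    rw [← sub_eq_zero] at hab ⊢
    rw [← map_sub] at hab
    have h0 : h ((a - b : U) : V) = 0 := by
      have := congrArg Subtype.val hab
      rwa [hhUr, LinearMap.coe_restrict_apply] at this
    exact Subtype.ext (hker _ h0)
  have hdet : LinearMap.det hUr ≠ 0 := by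
    have hunit : IsUnit hUr := (LinearMap.isUnit_iff_ker_eq_bot hUr).2 (LinearMap.ker_eq_bot.2 hUr_inj)
    exact (hunit.map LinearMap.det).ne_zero
  obtain ⟨L, hL, hprod⟩ := exists_eq_prod_dilations hUr hdet
  -- the dual vectors in `U'`
  choose fd hfdU' hfd using hdual
  set R : List (V × V × K) := L.map fun d => ((d.2.1 : V), fd d.1, d.2.2) with hRdef
  have hRprop : ∀ r ∈ R, r.1 ∈ U ∧ r.2.1 ∈ U' ∧ B r.1 r.1 = 0 ∧ B r.2.1 r.2.1 = 0 ∧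
      B r.1 r.2.1 = 1 ∧ r.2.2 ≠ 0 := by
    intro r hr
    obtain ⟨d, hd, rfl⟩ := List.mem_map.1 hr
    refine ⟨d.2.1.2, hfdU' d.1, hUU _ d.2.1.2 _ d.2.1.2, hU'U' _ (hfdU' d.1) _ (hfdU' d.1), ?_,
      (hL d hd).2⟩
    rw [hB.eq, hfd d.1 d.2.1]
    exact (hL d hd).1
  refine ⟨R, hRprop, ?_⟩
  set P : Module.End K V := (R.map fun r => rotation B r.1 r.2.1 r.2.2).prod with hPdef
  -- (a) on `U` the rotation word is the dilation word
  have hrotU : ∀ (d : Module.Dual K U × U × K) (x : U),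
      rotation B (d.2.1 : V) (fd d.1) d.2.2 x = (dilation d.1 d.2.1 d.2.2 x : U) := by
    intro d x
    rw [rotation_apply, dilation_apply, hUU _ d.2.1.2 _ x.2, mul_zero, zero_smul, add_zero,
      hfd d.1 x, Submodule.coe_add, Submodule.coe_smul]
  have hPU : ∀ (L : List (Module.Dual K U × U × K)) (x : U),
      ((L.map fun d => ((d.2.1 : V), fd d.1, d.2.2)).map fun r => rotation B r.1 r.2.1 r.2.2).prod
          (x : V) =
        ((L.map fun d => dilation d.1 d.2.1 d.2.2).prod x : U) := by
    intro L x
    induction L generalizing x with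
    | nil => simp
    | cons d L ih =>
      rw [List.map_cons, List.map_cons, List.prod_cons, Module.End.mul_apply, ih, hrotU,
        List.map_cons, List.prod_cons, Module.End.mul_apply]
  have hPeqU : ∀ u ∈ U, h u = P u := by
    intro u hu
    have h1 : h u = ((hUr ⟨u, hu⟩ : U) : V) := by rw [hhUr, LinearMap.coe_restrict_apply]
    rw [h1, hprod, hPdef, hRdef]
    exact (hPU L ⟨u, hu⟩).symm
  -- (b) `P` maps `U'` into `U'`, is an isometry, and fixes `(U + U')^⊥`
  have hPU' : ∀ (R' : List (V × V × K)), (∀ r ∈ R', r.2.1 ∈ U') →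
      ∀ x ∈ U', (R'.map fun r => rotation B r.1 r.2.1 r.2.2).prod x ∈ U' := by
    intro R' hR' x hx
    induction R' with
    | nil => simpa using hx
    | cons r R' ih =>
      rw [List.map_cons, List.prod_cons, Module.End.mul_apply]
      set y := (R'.map fun r => rotation B r.1 r.2.1 r.2.2).prod x with hy
      have hyU' : y ∈ U' := ih fun r' hr' => hR' r' (List.mem_cons_of_mem r hr')
      rw [rotation_apply, hU'U' _ (hR' r List.mem_cons_self) _ hyU', mul_zero, zero_smul, add_zero]
      exact U'.add_mem hyU' (U'.smul_mem _ (hR' r List.mem_cons_self))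
  have hPorth : B.IsOrthogonal P :=
    isOrthogonal_prod_rotations hB R fun r hr =>
      ⟨(hRprop r hr).2.2.1, (hRprop r hr).2.2.2.1, (hRprop r hr).2.2.2.2.1, (hRprop r hr).2.2.2.2.2⟩
  have hPfix : ∀ w ∈ B.orthogonal (U ⊔ U'), P w = w := by
    intro w hw
    rw [LinearMap.BilinForm.mem_orthogonal_iff] at hw
    have key : ∀ (R' : List (V × V × K)), (∀ r ∈ R', r.1 ∈ U ∧ r.2.1 ∈ U') →
        (R'.map fun r => rotation B r.1 r.2.1 r.2.2).prod w = w := by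
      intro R' hR'
      induction R' with
      | nil => simp
      | cons r R' ih =>
        rw [List.map_cons, List.prod_cons, Module.End.mul_apply,
          ih fun r' hr' => hR' r' (List.mem_cons_of_mem r hr'),
          rotation_apply_of_ortho _ (hw _ (Submodule.mem_sup_left (hR' r List.mem_cons_self).1))
            (hw _ (Submodule.mem_sup_right (hR' r List.mem_cons_self).2))]
    exact key R fun r hr => ⟨(hRprop r hr).1, (hRprop r hr).2.1⟩
  -- (c) `h = P` on `U'`: an isometry of this shape is determined by its restriction to `U`
  have hUr_surj : Function.Surjective hUr := LinearMap.surjective_of_injective hUr_inj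
  have hPeqU' : ∀ x ∈ U', h x = P x := by
    intro x hx
    rw [← sub_eq_zero]
    refine hsep _ (U'.sub_mem (hU' x hx) (hPU' R (fun r hr => (hRprop r hr).2.1) x hx)) fun u hu => ?_
    obtain ⟨u₀, hu₀⟩ := hUr_surj ⟨u, hu⟩
    have hu₀' : h (u₀ : V) = u := by
      have := congrArg Subtype.val hu₀
      rwa [hhUr, LinearMap.coe_restrict_apply] at this
    rw [map_sub, LinearMap.sub_apply, ← hu₀', hh, hPeqU _ u₀.2, hPorth, sub_self]
  -- (d) `U + U'` is nondegenerate, so `V = (U + U') ⊕ (U + U')^⊥`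
  have hWsep : ∀ w ∈ U ⊔ U', (∀ w' ∈ U ⊔ U', B w w' = 0) → w = 0 := by
    intro w hw hw'
    obtain ⟨u, hu, x, hx, rfl⟩ := Submodule.mem_sup.1 hw
    have hx0 : x = 0 := by
      refine hsep x hx fun u₂ hu₂ => ?_
      have h1 := hw' u₂ (Submodule.mem_sup_left hu₂)
      rwa [map_add, LinearMap.add_apply, hUU u hu u₂ hu₂, zero_add] at h1
    subst hx0
    rw [add_zero]
    have hu0 : (⟨u, hu⟩ : U) = 0 := by
      refine (Module.forall_dual_apply_eq_zero_iff K _).1 fun φ => ?_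
      rw [← hfd φ ⟨u, hu⟩, hB.eq]
      have h1 := hw' (fd φ) (Submodule.mem_sup_right (hfdU' φ))
      rwa [add_zero] at h1
    exact congrArg Subtype.val hu0
  have hWnd : (B.restrict (U ⊔ U')).Nondegenerate := by
    refine ⟨fun w hw => Subtype.ext (hWsep w w.2 fun w' hw' => ?_),
      fun w hw => Subtype.ext (hWsep w w.2 fun w' hw' => ?_)⟩
    · exact hw ⟨w', hw'⟩
    · rw [hB.eq]
      exact hw ⟨w', hw'⟩
  have hcompl : IsCompl (U ⊔ U') (B.orthogonal (U ⊔ U')) :=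
    LinearMap.BilinForm.isCompl_orthogonal_of_restrict_nondegenerate hB.isRefl hWnd
  -- (e) conclude
  refine LinearMap.ext fun x => ?_
  obtain ⟨w, hw, w', hw', rfl⟩ := Submodule.mem_sup.1
    (hcompl.sup_eq_top.symm ▸ Submodule.mem_top : x ∈ (U ⊔ U') ⊔ B.orthogonal (U ⊔ U'))
  obtain ⟨u, hu, y, hy, rfl⟩ := Submodule.mem_sup.1 hw
  change h (u + y + w') = P (u + y + w')
  rw [map_add, map_add, map_add, map_add, hPeqU u hu, hPeqU' y hy, hfix w' hw', hPfix w' hw']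


end OrthogonalGeneration

end Literature.AlgebraicGeometry.Motives

end
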